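import Summits.CriticalPhenomena.PercolationContinuityZ3.Theorems.PercNearOneGluingNoHeavyQuantCatHullTableSem
import HarnessLib

/-!
# QUANT lane R8, T-DEC: THE EXACT `shift` CHECK FOR PIECEWISE-AFFINE TABLES — an affine inequality on a box cut by a slab, decided on
# finitely many rational points, and its soundness

builds on p205010 (kernel theorem, internal audit signed; external expert review pending)

Support file (`--supports stmt-CriticalPhenomena-4575`), QUANT lane census seat prim-quant-census-2 (gen 78).  Definitions + theorems; standard
axioms, no sorries.  The `shift` field of `CatValueBoundS` for two tables `Ts` (offset `s`) and `Ts'` (offset `s' = s + δ`) sharing their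
`G`-grid reads `Ts'.Z G A + G·(ψ s' − ψ s) ≤ Ts.Z G (A + G·δ)`.  On a cell `(k,l)` of `Ts'` and for the `A`-cell `l'` of `Ts` containing `A + Gδ` the
difference of the two affine pieces is affine on the polygon `cell ∩ slab`; `Tab.shiftOK` decides its nonnegativity from the values at the ends of
the two relevant boundary lines (`Tab.shift_sound`).  [this work].  Nothing here is cited as a published result.  The gluing rows served
[cite: KozmaNitzan2024, Conjecture 3 (p. 15)]; product measure [cite: Grimmett1999, §1.3 p. 10].
-/

noncomputable section

namespace Summit.CriticalPhenomena.PercolationContinuityZ3.Theorems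
namespace Quant
namespace LawDec
namespace Tab

/-! ### Helpers on sorted breakpoint lists -/

/-- breakpoints of an increasing list are monotone in the index. [this work] -/
theorem getD_mono {bs : List ℚ} (h : sortedQ bs = true) : ∀ {i i' : ℕ}, i ≤ i' → i' + 1 ≤ bs.length → bs.getD i 0 ≤ bs.getD i' 0
  | i, 0, hi, _ => by rw [Nat.le_zero.1 hi]
  | i, i' + 1, hi, hl => by
    rcases Nat.lt_or_ge i (i' + 1) with hlt | hge
    · exact (getD_mono h (Nat.lt_succ_iff.1 hlt) (by omega)).trans (getD_le_getD_succ bs h i' (by omega))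
    · rw [le_antisymm hi hge]

/-- every term is below a common bound ⟹ so is the running maximum. [this work] -/
theorem zaux_le (T : Tab) (l : ℕ) (G A c : ℝ) : ∀ k, (∀ j, j ≤ k → T.term l G A j ≤ c) → T.zaux l G A k ≤ c
  | 0, h => h 0 le_rfl
  | k + 1, h => max_le (zaux_le T l G A c k fun j hj => h j (hj.trans (Nat.le_succ k))) (h (k + 1) le_rfl)

/-! ### The check -/

/-- an affine function of `G` (`α + β·G`) is nonnegative at both ends of `[g0, g1]` (checkable). [this work] -/
def endsOK (α β g0 g1 : ℚ) : Bool := decide (0 ≤ α + β * g0) && decide (0 ≤ α + β * g1)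

/-- soundness of `endsOK`. [this work] -/
theorem endsOK_sound {α β g0 g1 : ℚ} (h : endsOK α β g0 g1 = true) {G : ℝ} (h0 : (g0 : ℝ) ≤ G) (h1 : G ≤ g1) :
    0 ≤ (α : ℝ) + (β : ℝ) * G := by
  unfold endsOK at h; simp only [Bool.and_eq_true, decide_eq_true_eq] at h
  have e0 : (0 : ℝ) ≤ α + β * g0 := by exact_mod_cast h.1
  have e1 : (0 : ℝ) ≤ α + β * g1 := by exact_mod_cast h.2
  exact affine_nonneg_of_ends h0 h1 e0 e1

/-- nonnegativity of `d0 + d1·G + d2·A` on `{G ∈ [g0,g1], A ≥ lower boundaries}` resp. `A ≤ upper boundaries`, decided from two boundary lines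
`A = e` (horizontal) and `A = f − G·δ` (slanted): either line alone, or the two lines split at a rational `G*`. [this work] -/
def lineOK (d0 d1 d2 e f : ℚ) (δ : ℕ) (g0 g1 gs : ℚ) : Bool :=
  -- φ₁(G) = d0 + d2 e + d1 G ;  φ₂(G) = d0 + d2 f + (d1 - d2 δ) G
  endsOK (d0 + d2 * e) d1 g0 g1 || endsOK (d0 + d2 * f) (d1 - d2 * δ) g0 g1 ||
    (decide (g0 ≤ gs) && decide (gs ≤ g1) &&
      ((endsOK (d0 + d2 * e) d1 g0 gs && endsOK (d0 + d2 * f) (d1 - d2 * δ) gs g1) ||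
       (endsOK (d0 + d2 * f) (d1 - d2 * δ) g0 gs && endsOK (d0 + d2 * e) d1 gs g1)))

/-- soundness of `lineOK`: the affine function is nonnegative wherever it dominates both boundary minorants. [this work] -/
theorem lineOK_sound {d0 d1 d2 e f : ℚ} {δ : ℕ} {g0 g1 gs : ℚ} (h : lineOK d0 d1 d2 e f δ g0 g1 gs = true) {G A : ℝ}
    (hg0 : (g0 : ℝ) ≤ G) (hg1 : G ≤ g1)
    (hb : (0 ≤ (d2 : ℝ) ∧ (e : ℝ) ≤ A ∧ (f : ℝ) - G * δ ≤ A) ∨ ((d2 : ℝ) ≤ 0 ∧ A ≤ e ∧ A ≤ (f : ℝ) - G * δ)) :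
    0 ≤ (d0 : ℝ) + d1 * G + d2 * A := by
  -- the two boundary minorants
  have m1 : (d0 : ℝ) + d2 * e + d1 * G ≤ d0 + d1 * G + d2 * A := by
    rcases hb with ⟨hd, he, _⟩ | ⟨hd, he, _⟩ <;> nlinarith
  have m2 : (d0 : ℝ) + d2 * f + (d1 - d2 * δ) * G ≤ d0 + d1 * G + d2 * A := by
    rcases hb with ⟨hd, _, hf⟩ | ⟨hd, _, hf⟩ <;> nlinarith
  unfold lineOK at h
  simp only [Bool.or_eq_true, Bool.and_eq_true, decide_eq_true_eq] at h
  rcases h with (h1 | h2) | ⟨⟨hs0, hs1⟩, hsplit⟩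
  · have := endsOK_sound h1 hg0 hg1; push_cast at this; linarith
  · have := endsOK_sound h2 hg0 hg1; push_cast at this; linarith
  · rcases le_total G (gs : ℝ) with hG | hG
    · rcases hsplit with ⟨ha, _⟩ | ⟨ha, _⟩
      · have := endsOK_sound ha hg0 hG; push_cast at this; linarith
      · have := endsOK_sound ha hg0 hG; push_cast at this; linarith
    · rcases hsplit with ⟨_, hb'⟩ | ⟨_, hb'⟩
      · have := endsOK_sound hb' hG hg1; push_cast at this; linarith
      · have := endsOK_sound hb' hG hg1; push_cast at this; linarith

/-- coefficients of `D(G,A) = (own piece of Ts at cell (k,l'))(G, A + Gδ) − (clamped term j of Ts' at A-cell l)(G, A) − G·dψ`. [this work] -/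
def shiftD (Ts Ts' : Tab) (δ : ℕ) (dψ : ℚ) (k l l' j : ℕ) : ℚ × ℚ × ℚ :=
  let p := Ts.pc k l'
  let p' := Ts'.pc j l
  if j < k then (p.1 - p'.1 - p'.2.1 * Ts'.gb.getD (j + 1) 1, p.2.1 + p.2.2 * δ - dψ, p.2.2 - p'.2.2)
  else (p.1 - p'.1, p.2.1 + p.2.2 * δ - dψ - p'.2.1, p.2.2 - p'.2.2)

/-- the check for one `(k, l, l', j)`: the affine `D` is nonnegative on `cell(k,l) ∩ slab(l')`. [this work] -/
def shiftCellOK (Ts Ts' : Tab) (δ : ℕ) (dψ : ℚ) (k l l' j : ℕ) : Bool :=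
  let d := shiftD Ts Ts' δ dψ k l l' j
  let g0 := Ts'.gb.getD k 0
  let g1 := Ts'.gb.getD (k + 1) 0
  let a0 := Ts'.ab.getD l 0
  let a1 := Ts'.ab.getD (l + 1) 0
  let b0 := Ts.ab.getD l' 0
  let b1 := Ts.ab.getD (l' + 1) 0
  if 0 ≤ d.2.2 then lineOK d.1 d.2.1 d.2.2 a0 b0 δ g0 g1 (if δ = 0 then g0 else (b0 - a0) / δ)
  else lineOK d.1 d.2.1 d.2.2 a1 b1 δ g0 g1 (if δ = 0 then g0 else (b1 - a1) / δ)

/-- **the `shift` check** between `Ts` (offset `s`) and `Ts'` (offset `s' = s + δ`): all cells `(k,l)` of `Ts'`, all `A`-cells `l'` of `Ts` met by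
`A + Gδ`, all clamped terms `j ≤ k`. [this work] -/
def shiftOK (Ts Ts' : Tab) (δ : ℕ) (dψ : ℚ) : Bool :=
  decide (Ts.gb = Ts'.gb) &&
  (List.range (Ts'.gb.length - 1)).all fun k =>
    (List.range (Ts'.ab.length - 1)).all fun l =>
      let lo := idxQ Ts.ab (Ts'.ab.getD l 0 + Ts'.gb.getD k 0 * δ)
      let hi := idxQ Ts.ab (Ts'.ab.getD (l + 1) 0 + Ts'.gb.getD (k + 1) 0 * δ)
      (List.range (hi + 1 - lo)).all fun i => (List.range (k + 1)).all fun j => shiftCellOK Ts Ts' δ dψ k l (lo + i) j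

/-! ### Soundness -/

/-- **SOUNDNESS OF THE `shift` CHECK**: on the table domain, `Ts'.Z G A + G·dψ ≤ Ts.Z G (A + G·δ)`. [this work] -/
theorem shift_sound {Ts Ts' : Tab} {δ : ℕ} {dψ : ℚ} (h : shiftOK Ts Ts' δ dψ = true) (hw : Ts.wf = true) (hw' : Ts'.wf = true)
    {G A : ℝ} (hg0 : ((Ts'.gb.getD 0 0 : ℚ) : ℝ) ≤ G) (hg1 : G ≤ ((Ts'.gb.getLast?.getD 0 : ℚ) : ℝ))
    (ha0 : ((Ts'.ab.getD 0 0 : ℚ) : ℝ) ≤ A) (ha1 : A ≤ ((Ts'.ab.getLast?.getD 0 : ℚ) : ℝ))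
    (hb0 : ((Ts.ab.getD 0 0 : ℚ) : ℝ) ≤ A + G * δ) (hb1 : A + G * δ ≤ ((Ts.ab.getLast?.getD 0 : ℚ) : ℝ)) :
    Ts'.Z G A + G * dψ ≤ Ts.Z G (A + G * δ) := by
  have hwf := hw; have hwf' := hw'
  unfold wf at hw hw'
  simp only [Bool.and_eq_true, decide_eq_true_eq] at hw hw'
  obtain ⟨⟨⟨⟨⟨hlen, hsort⟩, halen⟩, _⟩, _⟩, hasort⟩ := hw
  obtain ⟨⟨⟨⟨⟨hlen', hsort'⟩, halen'⟩, _⟩, _⟩, hasort'⟩ := hw'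
  unfold shiftOK at h
  simp only [Bool.and_eq_true, decide_eq_true_eq] at h
  obtain ⟨hgb, hall⟩ := h
  -- indices of the point
  set k := idx Ts'.gb G with hk
  set l := idx Ts'.ab A with hl
  set l' := idx Ts.ab (A + G * δ) with hl'
  have hk2 : k + 2 ≤ Ts'.gb.length := idx_lt _ _ hlen'
  have hl2 : l + 2 ≤ Ts'.ab.length := idx_lt _ _ halen'
  have hl'2 : l' + 2 ≤ Ts.ab.length := idx_lt _ _ halen
  -- cell bounds
  have cg0 : ((Ts'.gb.getD k 0 : ℚ) : ℝ) ≤ G := getD_idx_le _ _ hg0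
  have cg1 : G ≤ ((Ts'.gb.getD (k + 1) 0 : ℚ) : ℝ) := le_getD_idx_succ _ _ hlen' hg1
  have ca0 : ((Ts'.ab.getD l 0 : ℚ) : ℝ) ≤ A := getD_idx_le _ _ ha0
  have ca1 : A ≤ ((Ts'.ab.getD (l + 1) 0 : ℚ) : ℝ) := le_getD_idx_succ _ _ halen' ha1
  have cb0 : ((Ts.ab.getD l' 0 : ℚ) : ℝ) ≤ A + G * δ := getD_idx_le _ _ hb0
  have cb1 : A + G * δ ≤ ((Ts.ab.getD (l' + 1) 0 : ℚ) : ℝ) := le_getD_idx_succ _ _ halen hb1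
  -- l' lies in the checked range
  set lo := idxQ Ts.ab (Ts'.ab.getD l 0 + Ts'.gb.getD k 0 * δ) with hlo
  set hi := idxQ Ts.ab (Ts'.ab.getD (l + 1) 0 + Ts'.gb.getD (k + 1) 0 * δ) with hhi
  have hδ0 : (0 : ℝ) ≤ δ := Nat.cast_nonneg δ
  have hlol' : lo ≤ l' := by
    rw [hlo, ← idx_cast, hl']
    refine idx_mono _ ?_; push_cast; nlinarith
  have hl'hi : l' ≤ hi := by
    rw [hhi, ← idx_cast, hl']
    refine idx_mono _ ?_; push_cast; nlinarith
  -- extract the check for (k, l, l', j)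
  rw [List.all_eq_true] at hall
  have hK := hall k (List.mem_range.2 (by omega)); rw [List.all_eq_true] at hK
  have hL := hK l (List.mem_range.2 (by omega)); rw [List.all_eq_true] at hL
  have hI := hL (l' - lo) (List.mem_range.2 (by omega)); rw [List.all_eq_true] at hI
  have hlo' : lo + (l' - lo) = l' := by omega
  -- RHS ≥ own piece of Ts at (k, l')
  have hkR : idx Ts.gb G = k := by rw [hk, hgb]
  have rhs_ge : Ts.term l' G (A + G * δ) k ≤ Ts.Z G (A + G * δ) := by
    have := Z_ge_term Ts G (A + G * δ); rwa [hkR] at this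
  -- G ≤ gb[k+1] so the own term of Ts at k is the plain piece
  have eqg : Ts.gb.getD (k + 1) 1 = Ts'.gb.getD (k + 1) 0 := by
    rw [hgb, List.getD_eq_getElem _ _ (by omega : k + 1 < Ts'.gb.length), List.getD_eq_getElem _ _ (by omega : k + 1 < Ts'.gb.length)]
  have hmin : min G ((Ts.gb.getD (k + 1) 1 : ℚ) : ℝ) = G := min_eq_left (by rw [eqg]; exact cg1)
  -- bound every clamped term of Ts'
  have key : ∀ j, j ≤ k → Ts'.term l G A j ≤ Ts.term l' G (A + G * δ) k - G * dψ := by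
    intro j hj
    have hc := hI j (List.mem_range.2 (Nat.lt_succ_of_le hj))
    rw [hlo'] at hc
    unfold shiftCellOK at hc
    unfold term ev
    rw [hmin]
    by_cases hjk : j < k
    · -- earlier cell: the clamped reach is gb[j+1] ≤ G
      have hle : ((Ts'.gb.getD (j + 1) 1 : ℚ) : ℝ) ≤ G := by
        have e1 : Ts'.gb.getD (j + 1) 1 = Ts'.gb.getD (j + 1) 0 := by
          rw [List.getD_eq_getElem _ _ (by omega : j + 1 < Ts'.gb.length), List.getD_eq_getElem _ _ (by omega : j + 1 < Ts'.gb.length)]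
        rw [e1]
        refine le_trans ?_ cg0
        exact_mod_cast getD_mono hsort' (by omega : j + 1 ≤ k) (by omega)
      rw [min_eq_right hle]
      simp only [shiftD, if_pos hjk] at hc
      by_cases hd : 0 ≤ (Ts.pc k l').2.2 - (Ts'.pc j l).2.2
      · rw [if_pos hd] at hc
        have := lineOK_sound hc cg0 cg1 (Or.inl ⟨by exact_mod_cast hd, ca0, by linarith⟩)
        push_cast at this; nlinarith
      · rw [if_neg hd] at hc
        have hd' : (Ts.pc k l').2.2 - (Ts'.pc j l).2.2 ≤ 0 := (not_le.1 hd).le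
        have := lineOK_sound hc cg0 cg1 (Or.inr ⟨by exact_mod_cast hd', ca1, by linarith⟩)
        push_cast at this; nlinarith
    · -- own cell j = k
      have hjk' : j = k := le_antisymm hj (not_lt.1 hjk)
      rw [hjk']
      have hgj : ((Ts'.gb.getD (k + 1) 1 : ℚ) : ℝ) = ((Ts'.gb.getD (k + 1) 0 : ℚ) : ℝ) := by
        rw [List.getD_eq_getElem _ _ (by omega : k + 1 < Ts'.gb.length), List.getD_eq_getElem _ _ (by omega : k + 1 < Ts'.gb.length)]
      have hmin' : min G ((Ts'.gb.getD (k + 1) 1 : ℚ) : ℝ) = G := min_eq_left (by rw [hgj]; exact cg1)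
      rw [hmin']
      rw [hjk'] at hc
      simp only [shiftD, lt_irrefl, if_false] at hc
      by_cases hd : 0 ≤ (Ts.pc k l').2.2 - (Ts'.pc k l).2.2
      · rw [if_pos hd] at hc
        have := lineOK_sound hc cg0 cg1 (Or.inl ⟨by exact_mod_cast hd, ca0, by linarith⟩)
        push_cast at this; nlinarith
      · rw [if_neg hd] at hc
        have hd' : (Ts.pc k l').2.2 - (Ts'.pc k l).2.2 ≤ 0 := (not_le.1 hd).le
        have := lineOK_sound hc cg0 cg1 (Or.inr ⟨by exact_mod_cast hd', ca1, by linarith⟩)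
        push_cast at this; nlinarith
  have hz : Ts'.Z G A ≤ Ts.term l' G (A + G * δ) k - G * dψ := by
    unfold Z; rw [← hk, ← hl]
    exact zaux_le Ts' l G A _ k key
  linarith

end Tab
end LawDec
end Quant
end Summit.CriticalPhenomena.PercolationContinuityZ3.Theorems
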